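import Summits.CriticalPhenomena.PercolationContinuityZ3.Theorems.Transplant.SkelSignClosureCentred
import Summits.CriticalPhenomena.PercolationContinuityZ3.Theorems.Transplant.SkelPhiFaceResidue
import Summits.CriticalPhenomena.PercolationContinuityZ3.Theorems.Transplant.SkelPhiCellsConcGLevels
import Summits.CriticalPhenomena.PercolationContinuityZ3.Theorems.Transplant.SkelChainUP
import HarnessLib

/-!
# D″ node, the (Z″) PARTIAL CLOSURE FROM THE THREE RESIDUES (DPRIME-SCOPE §2 L7′; DP1/DP10): `samePDropOfSkeletonSign_of_concSG_residuesRH` —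
# φ-level/`PlanarSkeletonSign` twin of the node of record's `SkelConc.samePDropOfSkeletonConcLt_of_concSG_residuesRH` (SkelConcClosureHab §2):
# the p-free constants (ONE chain accuracy for every corridor-chain length `≤ nmaxC` from `SkelConc.chain_edge_subgraph_UP`, the face accuracy
# from `apply_step_subgraph_UP`, the root-chain accuracies, `K₀`) are produced HERE; the instance receives them and the Step-I′ data and returns,
# at the running density, two-unit cells `P : PCells2`, a schedule `Λ` with `Skelφ.WFS2 P Λ`, `K₀ ≤ P.K`, and the three residues
# `Skel.RootOblT` / `Skelφ.FaceOblR` / `Skel.ReachOblRH` at the scheme `⟨Skelφ.cellGeomSG G Φ.φ P t Λ, q, δ⟩`; hp-8 g30's `Skelφ.kitAtRun_of_oblRH`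
# and p2-g7's six records turn that into `KitAtRun`, and `samePDropOfSkeletonSign_of_stepI_run_centred` (p3) into the node

builds on p205010 (kernel theorem, internal audit signed; external expert review pending) — nothing in this file uses p205010.
Lane `prim-bschramm`, seat `prim-bschramm-p3` (gen 7; D″ design owner); helper file (`--supports stmt-CriticalPhenomena-4575`).
* §1 `Skelφ.δUP G hΔ n ε` / `δUP_pos` / `δUP_le_one` / `δUP_spec` (the accuracy of `SkelConc.chain_edge_subgraph_UP G hΔ n hε` as a function — graph +
  degree bound only), `Skelφ.δC G hΔ ε` (`min` over `n ≤ nmaxC`) / `δC_pos` / `δC_le_one` / `δC_le_δUP` / `δC_spec`;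
* §2 **`PlanarSkeletonSign.samePDropOfSkeletonSign_of_concSG_residuesRH (hres) : SamePDropOfSkeletonSign`**.
[cite: KozmaNitzan2024, §4 Theorem 6 (pp. 25–31), (30), (32), Lemmas 10–12; §1 p. 2 (approach 1)] [cite: Hutchcroft2016, Thm. 1]
-/

noncomputable section

open MeasureTheory ProbabilityTheory
open scoped ENNReal Classical

namespace Summit.CriticalPhenomena.PercolationContinuityZ3.Theorems.Transplant

open Literature.Probability.Percolation Literature.Probability.LatticeModels SimpleGraph KNCells KNLevels
open Literature.Barriers.CriticalPhenomena (HasExponentialGrowth)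
open BoxProdZ2 (ConcRadiiG)

/-! ## §1 Chain accuracies as functions of the graph and a degree bound -/

namespace Skelφ

variable {V : Type} [DecidableEq V] [Countable V] (G : SimpleGraph V) [G.LocallyFinite] {Δ : ℕ} (hΔ : ∀ v, G.degree v ≤ Δ)

/-- **The chain accuracy of `SkelConc.chain_edge_subgraph_UP G hΔ n`** for chains of `n + 1` steps delivering `1 − ε` (`1` off `0 < ε`) — the
φ-level (graph + degree bound) form of `SkelConc.δUP Φ`. [this work] -/
def δUP (n : ℕ) (ε : ℝ) : ℝ :=
  if hε : 0 < ε then Classical.choose (SkelConc.chain_edge_subgraph_UP G hΔ n hε) else 1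

/-- `0 < δUP`. [folklore] -/
theorem δUP_pos (n : ℕ) (ε : ℝ) : 0 < δUP G hΔ n ε := by
  unfold δUP; split_ifs with hε
  · exact (Classical.choose_spec (SkelConc.chain_edge_subgraph_UP G hΔ n hε)).1
  · exact one_pos

/-- `δUP ≤ 1`. [folklore] -/
theorem δUP_le_one (n : ℕ) (ε : ℝ) : δUP G hΔ n ε ≤ 1 := by
  unfold δUP; split_ifs with hε
  · exact (Classical.choose_spec (SkelConc.chain_edge_subgraph_UP G hΔ n hε)).2.1
  · exact le_rfl

/-- **Specification of `δUP`** (every `q < 1`, every subgraph `G' ≤ G`, every weighting). [cite: KozmaNitzan2024, §4 Lemma 12 (pp. 23–25)] -/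
theorem δUP_spec (n : ℕ) {ε : ℝ} (hε : 0 < ε) :
    ∀ (q : unitInterval), (q : ℝ) < 1 → ∀ (G' : SimpleGraph V) [G'.LocallyFinite], G' ≤ G →
      ∀ (Wt : Sym2 V → unitInterval) (s : Fin (n + 1) → TStep G') (T' : Fin (n + 1) → Finset V) (η : ℝ),
      (∀ i : Fin (n + 1), (s i).L.o = (s 0).L.o) →
      (∀ i : Fin n, T' (Fin.castSucc i) ⊆ (s i.succ).L.X 0) →
      (∀ i : Fin (n + 1), T' i ⊆ (s i).T) →
      (∀ i : Fin (n + 1), (s i).KitsAt Wt q Δ (δUP G hΔ n ε)) →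
      η ≤ δUP G hΔ n ε / 2 →
      (∀ i : Fin (n + 1), (prodBernoulli Wt).real (⋃ t ∈ (s i).T \ T' i, openConn (s 0).L.o t) ≤ η) →
      1 - δUP G hΔ n ε < (prodBernoulli Wt).real (s 0).L.reachB →
        1 - ε < (prodBernoulli Wt).real (⋃ t ∈ T' (Fin.last n), openConn (s 0).L.o t) := by
  have e : δUP G hΔ n ε = Classical.choose (SkelConc.chain_edge_subgraph_UP G hΔ n hε) := by unfold δUP; rw [dif_pos hε]
  rw [e]
  exact (Classical.choose_spec (SkelConc.chain_edge_subgraph_UP G hΔ n hε)).2.2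

/-- **One corridor-chain accuracy for every length `n ≤ nmaxC`**: `δC := min_{n ≤ nmaxC} δUP n ε`. [this work] -/
def δC (ε : ℝ) : ℝ :=
  ((Finset.range (Skel.nmaxC + 1)).image fun n => δUP G hΔ n ε).min' ⟨δUP G hΔ 0 ε, Finset.mem_image.2 ⟨0, by simp, rfl⟩⟩

/-- `δC ≤ δUP n ε` for every `n ≤ nmaxC`. [folklore] -/
theorem δC_le_δUP (ε : ℝ) {n : ℕ} (hn : n ≤ Skel.nmaxC) : δC G hΔ ε ≤ δUP G hΔ n ε :=
  Finset.min'_le _ _ (Finset.mem_image.2 ⟨n, Finset.mem_range.2 (Nat.lt_succ_of_le hn), rfl⟩)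

/-- `0 < δC`. [folklore] -/
theorem δC_pos (ε : ℝ) : 0 < δC G hΔ ε := by
  unfold δC
  refine (Finset.lt_min'_iff _ _).2 fun y hy => ?_
  obtain ⟨n, -, rfl⟩ := Finset.mem_image.1 hy
  exact δUP_pos G hΔ n _

/-- `δC ≤ 1`. [folklore] -/
theorem δC_le_one (ε : ℝ) : δC G hΔ ε ≤ 1 := (δC_le_δUP G hΔ ε (Nat.zero_le _)).trans (δUP_le_one G hΔ 0 _)

/-- **The chain property of every length `n ≤ nmaxC` at the accuracy `δC`**, in every subgraph `G' ≤ G`, for every `q < 1`, delivering `1 − ε`.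
[cite: KozmaNitzan2024, §4 Lemma 12 (pp. 23–25)] -/
theorem δC_spec {ε : ℝ} (hε : 0 < ε) {n : ℕ} (hn : n ≤ Skel.nmaxC) {q : unitInterval} (hq1 : (q : ℝ) < 1)
    (G' : SimpleGraph V) [G'.LocallyFinite] (hG' : G' ≤ G) :
    ∀ (Wt : Sym2 V → unitInterval) (s : Fin (n + 1) → TStep G') (T' : Fin (n + 1) → Finset V) (η : ℝ),
      (∀ i : Fin (n + 1), (s i).L.o = (s 0).L.o) →
      (∀ i : Fin n, T' (Fin.castSucc i) ⊆ (s i.succ).L.X 0) →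
      (∀ i : Fin (n + 1), T' i ⊆ (s i).T) →
      (∀ i : Fin (n + 1), (s i).KitsAt Wt q Δ (δC G hΔ ε)) →
      η ≤ δC G hΔ ε / 2 →
      (∀ i : Fin (n + 1), (prodBernoulli Wt).real (⋃ t ∈ (s i).T \ T' i, openConn (s 0).L.o t) ≤ η) →
      1 - δC G hΔ ε < (prodBernoulli Wt).real (s 0).L.reachB →
        1 - ε < (prodBernoulli Wt).real (⋃ t ∈ T' (Fin.last n), openConn (s 0).L.o t) := by
  intro Wt s T' η ho hlink hsub hkits hη hexc hsrc
  have hle := δC_le_δUP G hΔ ε hn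
  exact δUP_spec G hΔ n hε q hq1 G' hG' Wt s T' η ho hlink hsub (fun i => (hkits i).mono hle) (hη.trans (by linarith)) hexc
    (by linarith)

end Skelφ

/-! ## §2 The D″ node from the three residues at the two-unit concentric scheme -/

namespace PlanarSkeletonSign

/-- **THE D″ v2 PARTIAL CLOSURE, run-restricted habitat form.**  Suppose that for all p-free constants `K₀ δ δ₂ δr` (with their bounds), every
locally finite `G` NOT of exponential growth with a `PlanarSkeletonSign Φ`, every CENTRED base vertex `t` (`Φ.φ t = 0`) and every `0 < p < 1`
with Φ2 (`hC`), the instance names `δI > 0`, `m₀`, receives Step-I′ data `D, off, M₀, n₁` with the seven facts, and returns finite lists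
`Sz Sx Sy` (admissible) such that at every `q ∈ [p/2, p]` where the Step-I′ family holds with accuracy `δI` under Φ2 there are two-unit cells
`P : PCells2` and a schedule `Λ` with `Skelφ.WFS2 P Λ`, `K₀ ≤ P.K` and the three residues `Skel.RootOblT … δr`, `Skelφ.FaceOblR … δ₂`,
`Skel.ReachOblRH … δ` at the scheme `⟨Skelφ.cellGeomSG G Φ.φ P t Λ, q, δ⟩` (degree parameter `Φ.Δ`).  Then `SamePDropOfSkeletonSign`.
[cite: KozmaNitzan2024, §4 Theorem 6 (pp. 25–31); §1 p. 2 (approach 1)] -/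
theorem samePDropOfSkeletonSign_of_concSG_residuesRH
    (hres : ∀ (K₀ : ℕ) (δ δ₂ : ℝ) (δr : ℕ → ℝ), 0 < δ → δ ≤ 1 → 0 < δ₂ → δ₂ ≤ 1 → (∀ n, 0 < δr n ∧ δr n ≤ 1) →
      ∀ {V : Type} [DecidableEq V] [Countable V] (G : SimpleGraph V) [G.LocallyFinite] (Φ : PlanarSkeletonSign G),
        ¬ HasExponentialGrowth G → ∀ t ∈ Φ.types, Φ.φ t = 0 → ∀ p : unitInterval, 0 < (p : ℝ) → (p : ℝ) < 1 →
          ∀ hC : Φ.CylSubcritical p,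
            ∃ (δI : ℝ) (m₀ : ℕ), 0 < δI ∧
              ∀ (D : Skelφ.StepI.Data V) (off M₀ n₁ : ℕ), m₀ ≤ D.k → 1 ≤ D.k → D.R = Skelφ.fatRadius Φ.frame hC →
                D.Λ = Skelφ.fatSeqOff Φ.frame hC off → D.k < M₀ → D.k < n₁ → (∀ ℓ, D.k ≤ D.Gb ℓ ∧ D.k ≤ D.Fb ℓ) →
                ∃ Sz Sx Sy : Finset ℕ, (∀ M ∈ Sz, M₀ ≤ M) ∧ (∀ ℓ ∈ Sx, n₁ ≤ ℓ) ∧ (∀ ℓ ∈ Sy, n₁ ≤ ℓ) ∧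
                  ∀ q : unitInterval, (p : ℝ) / 2 ≤ q → (q : ℝ) ≤ p →
                    (∀ i ∈ Skelφ.StepI.index Φ.types Sz Sx Sy,
                      1 - δI < (bondPercolation G q).real (Skelφ.StepI.event G Φ.φ D i)) →
                    Φ.CylSubcritical q →
                      ∃ (P : PCells2) (Λ : ConcRadiiG), Skelφ.WFS2 P Λ ∧ K₀ ≤ P.K ∧
                        Skel.RootOblT G (⟨Skelφ.cellGeomSG G Φ.φ P t Λ, q, δ⟩ : KSchA V ℕ) Φ.Δ δr ∧
                        Skelφ.FaceOblR G Φ.φ (⟨Skelφ.cellGeomSG G Φ.φ P t Λ, q, δ⟩ : KSchA V ℕ) (Skelφ.faceDataSG G Φ.φ P t Λ) Φ.Δ δ₂ ∧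
                        Skel.ReachOblRH G (⟨Skelφ.cellGeomSG G Φ.φ P t Λ, q, δ⟩ : KSchA V ℕ) (Skelφ.faceDataSG G Φ.φ P t Λ) Φ.Δ δ) :
    SamePDropOfSkeletonSign := by
  refine samePDropOfSkeletonSign_of_stepI_run_centred fun {V} _ _ G _ Φ hg t ht h0 p hp0 hp1 hU hC hθ => ?_
  -- the p-free constants (`Φ.Δ` is the degree parameter; one chain accuracy for every corridor-chain length `≤ nmaxC`)
  have hε' : (0 : ℝ) < (1 / 2) ^ 35 := by positivity
  have hΔ : ∀ v, G.degree v ≤ Φ.Δ := Φ.degree_le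
  obtain ⟨δ, hδ0, hδ1, hchainH⟩ : ∃ δ : ℝ, 0 < δ ∧ δ ≤ 1 ∧ ∀ n ≤ Skel.nmaxC, ∀ (q : unitInterval), (q : ℝ) < 1 →
      ∀ (G' : SimpleGraph V) [G'.LocallyFinite], G' ≤ G →
        ∀ (Wt : Sym2 V → unitInterval) (s : Fin (n + 1) → TStep G') (T' : Fin (n + 1) → Finset V) (η : ℝ),
        (∀ i : Fin (n + 1), (s i).L.o = (s 0).L.o) →
        (∀ i : Fin n, T' (Fin.castSucc i) ⊆ (s i.succ).L.X 0) →
        (∀ i : Fin (n + 1), T' i ⊆ (s i).T) →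
        (∀ i : Fin (n + 1), (s i).KitsAt Wt q Φ.Δ δ) →
        η ≤ δ / 2 →
        (∀ i : Fin (n + 1), (prodBernoulli Wt).real (⋃ t ∈ (s i).T \ T' i, openConn (s 0).L.o t) ≤ η) →
        1 - δ < (prodBernoulli Wt).real (s 0).L.reachB →
          1 - (1 / 2 : ℝ) ^ 35 < (prodBernoulli Wt).real (⋃ t ∈ T' (Fin.last n), openConn (s 0).L.o t) :=
    ⟨Skelφ.δC G hΔ ((1 / 2) ^ 35), Skelφ.δC_pos G hΔ _, Skelφ.δC_le_one G hΔ _,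
      fun n hn q hq1 G' _ hG' => Skelφ.δC_spec G hΔ hε' hn hq1 G' hG'⟩
  obtain ⟨δ₂, hδ₂0, hδ₂1, hstep⟩ := SkelConc.apply_step_subgraph_UP G hΔ (half_pos hδ0)
  have hrc := fun n : ℕ => SkelConc.chain_edge_subgraph_UP G hΔ n hδ0
  choose δr hδr0 hδr1 hchainr using hrc
  obtain ⟨K₀, hK₀⟩ := exists_pow_lt_of_lt_one hε' (show 1 - δ₂ < 1 by linarith)
  -- the instance at `p`
  obtain ⟨δI, m₀, hδI, hS⟩ := hres K₀ δ δ₂ δr hδ0 hδ1 hδ₂0 hδ₂1 (fun n => ⟨hδr0 n, hδr1 n⟩) G Φ hg t ht h0 p hp0 hp1 hC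
  refine ⟨δI, m₀, hδI, fun D off M₀ n₁ hk₀ hk₁ hR hΛ hM₀ hn₁ hGF => ?_⟩
  obtain ⟨Sz, Sx, Sy, hSz, hSx, hSy, hB⟩ := hS D off M₀ n₁ hk₀ hk₁ hR hΛ hM₀ hn₁ hGF
  refine ⟨Sz, Sx, Sy, hSz, hSx, hSy, fun q hq1 hq2 hcq hCq => ?_⟩
  -- (B) at `q`
  have hq1' : (q : ℝ) < 1 := lt_of_le_of_lt hq2 hp1
  obtain ⟨P, Λ, hWF, hK, hroot, hfaceO, hreachO⟩ := hB q hq1 hq2 hcq hCq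
  have hlip : Skelφ.Lip G Φ.φ := Φ.toPlanarSkeletonNeg.lip_skelφ
  have hsteps : Skelφ.Steps G Φ.φ := Φ.toPlanarSkeletonNeg.steps_skelφ
  refine ⟨ℕ, ⟨Skelφ.cellGeomSG G Φ.φ P t Λ, q, δ⟩, Skelφ.faceDataSG G Φ.φ P t Λ, Skelφ.levelDataS Φ.φ P, (1 / 2) ^ 35, δ₂, rfl, rfl,
    Skelφ.runGeomSG P t, Skelφ.anchGeomSG P t, Skelφ.sepGeom₂SG P t hWF h0 hsteps, Skelφ.exitGeomSG P t hWF hlip,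
    Skelφ.stepsGeomSG P t hWF hsteps, Skelφ.levelGeomSG P t hWF hlip, hδ1, hε'.le, hδ₂1, ?_, ?_⟩
  · -- `4((1-δ₂)^K + 2⁻³⁵) ≤ 2⁻³²` since `K ≥ K₀`
    have hKpow : (1 - δ₂) ^ P.K ≤ (1 / 2 : ℝ) ^ 35 :=
      (pow_le_pow_of_le_one (by linarith) (by linarith) hK).trans hK₀.le
    have h32 : (4 : ℝ) * ((1 / 2) ^ 35 + (1 / 2) ^ 35) = (1 / 2) ^ 32 := by norm_num
    show 4 * ((1 - δ₂) ^ P.K + (1 / 2 : ℝ) ^ 35) ≤ (1 / 2) ^ 32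
    linarith
  · exact Skelφ.kitAtRun_of_oblRH (S := ⟨Skelφ.cellGeomSG G Φ.φ P t Λ, q, δ⟩) hlip le_rfl
      (fun c Rπ => hstep q hq1' (Skel.winGraph G c Rπ) (Skel.winGraph_le G c Rπ))
      (fun n hn Ω => hchainH n hn q hq1' (Skel.winGraphIn G Ω) (Skel.winGraphIn_le G Ω))
      (fun n c Rπ => hchainr n q hq1' (Skel.winGraph G c Rπ) (Skel.winGraph_le G c Rπ)) hroot hfaceO hreachO

end PlanarSkeletonSign

end Summit.CriticalPhenomena.PercolationContinuityZ3.Theorems.Transplant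

end
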